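import Summits.QuantumFields.YangMills.Theorems.AlphaInputsT3ACNorm35LogZTRowsOfLeaves
import Summits.QuantumFields.YangMills.Theorems.AlphaInputsT3ACFlatLoewnerLetters
import HarnessLib

/-!
# `AlphaInputsT3ACFlatGaussianDefs` (the B0∣_{U=1} definer's file 1 of 2; drafted as `B0FlatDefs` by px8 g17) — the B0∣_{U=1} DEFINER's `def`s: the six (63)-representation fields `dimT, QT, JT; dimZ h, Q1 h, J1 h` of
# `Carriers.StepSeries` over the NAMED [B6] torus objects `elimT` ∕ `deltaPol` ∕ `elimLam`, the Λ'₀(h) corner rule `lab`∕`lamCoarse`, and the proof-scaffolding `def`s of the rows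
# file (`dimC, eC, inclLam, splitEquiv, sigmaT, QTsplit, badPts, cvT, cJT, withT, withTZ, subFinsetEquiv`) — with the seals `attribute [irreducible] dimT dimZ dimC` (KERNEL NOTE K1)

Split of px8 g17's (O-B0flat) UNFILED KERNEL DRAFT v3 `B0FlatDraft.v3.px8g17.lean` (sha16 1460941a58ff854b; 19936 evidence #47; ★★OWNER g36 RECORDs 17cp∕17cq) into the two files the
B0-DEFINER seat proposes: THIS file `--kind definition` (review-queued), then `AlphaInputsT3ACFlatGaussianRows` (def-free, `--supports stmt-QuantumFields-19936 --as helper`).  Decisions recorded in the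
docstrings: D1 (no (22) `const` in `JT`∕`J1`), D2 (corner rule for Λ'₀(h)), D3 ([B9] p.428 L8–14 licence for «Δ_k(1) := the [B5] (1.66) form»).  Namespace `…Theorems.AlphaInputsT3ACFlatGaussian`
(shared with the rows file).  No `instance`,
no `notation`; every `def` carries a docstring.  KERNEL NOTE (K1): the ℕ-valued `Fintype.card` defs `dimT dimZ dimC` are SEALED `[irreducible]` after the `Fintype.equivFin`
charts `eT eZ eC splitEquiv sigmaT` are typed — unsealed, a consumer's `(𝔖 k).dimT =?= dimT S k` is a whnf timeout; `unfold`∕`rw [dimT]` still work through the seal.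
Nothing of [Balaban1985UV3] is asserted; (α) data rows 0∕23; rung R3 = SU(2) YM₃ on T³ — NOT d = 4, NOT infinite volume, NOT a mass gap, NOT Clay.
References: T. Bałaban, CMP 102 (1985) 255–275 [Balaban1985UV3] ((22) p.261, (35) p.265, (61)–(63) pp.271–272); CMP 96 (1984) 223–250 [Balaban1984PropagatorsII]
((2.152)–(2.157) pp.249–250); CMP 95 (1984) 17–40 [Balaban1984PropagatorsI] ((1.66)–(1.67) p.29); CMP 99 (1985) 389–434 [Balaban1985BackgroundPropagators] (p.428).
-/

set_option autoImplicit false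

noncomputable section

open MeasureTheory Finset Matrix

namespace Summit.QuantumFields.YangMills.Theorems.AlphaInputsT3ACFlatGaussian

open Literature.MathematicalPhysics.QuantumFieldTheory.Balaban1983to89
open Literature.MathematicalPhysics.QuantumFieldTheory.Balaban1983to89.B6Lemma24Torus (pbox coarseSites faces mem_faces)
open Literature.MathematicalPhysics.QuantumFieldTheory.Balaban1983to89.B6Cov2156Torus (freeT elimT deltaPol gamma2153)
open Literature.MathematicalPhysics.QuantumFieldTheory.Balaban1983to89.B6Cov2156TorusSubset (elimTS lamFree lamFree_subset elimLam)
open Literature.MathematicalPhysics.QuantumFieldTheory.Balaban1983to89.B6LowerBound2153Torus (facesOf)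
open Literature.MathematicalPhysics.QuantumFieldTheory.Balaban1983to89.B10Eq35Norm (Norm35Model)
open Literature.MathematicalPhysics.QuantumFieldTheory.Balaban1985CMP102
open Literature.MathematicalPhysics.QuantumFieldTheory.Balaban1985CMP102.Setting
open Literature.MathematicalPhysics.QuantumFieldTheory.Balaban1985CMP102.Binders (Norm35StepAsCited LogZTExtensiveAsCited LogZTModel)
open Summit.QuantumFields.Balaban3D.Carriers
open Summit.QuantumFields.Balaban3D.Proofs.ScalesArithmetic (sites_eq_card P_d P_L P_m P_K)
open Summit.QuantumFields.Balaban3D.Proofs.Inputs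
open Summit.QuantumFields.Balaban3D.Proofs.TowerAC
open Summit.QuantumFields.Balaban3D.Proofs.SeriesAC
open Summit.QuantumFields.Balaban3D.Proofs.StandardAC
open Summit.QuantumFields.Balaban3D.Proofs.InputsAC
open Summit.QuantumFields.YangMills.Theorems.AlphaInputsT3ACNorm35LogZTRowsOfLeaves
  (logZTExtensiveAsCited_piecesAC_of_loewner piecesAC_logZT_eq piecesAC_logZ1_eq)
open Summit.QuantumFields.YangMills.Theorems.AlphaInputsT3ACFlatLoewnerLetters (loewner_letters_reindex_blockDiagonal)

/-! ## §0 Folklore -/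

section Folklore

/-- `{f : ↥T // ↑f ∈ S} ≃ ↥S` for Finsets `S ⊆ T` (both directions compute). [folklore] -/
def subFinsetEquiv {α : Type} (S T : Finset α) (hS : S ⊆ T) : {f : ↥T // (f : α) ∈ S} ≃ ↥S where
  toFun f := ⟨f.1.1, f.2⟩
  invFun b := ⟨⟨b.1, hS b.2⟩, b.2⟩
  left_inv _ := rfl
  right_inv _ := rfl

end Folklore

/-! ## §1 The six fields over the named [B6] objects -/

section Defs

variable {L : ℕ} (S : Scales L) (k : ℕ)

/-- The sides of the unit torus `T₁^{(k)}`: `Mₖ = 2·L^{m+K−k}` sites in each of the three directions (`Setup.Params.sitesPerDir`).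
[cite: Balaban1985UV3, (5) p.256] -/
abbrev sideT : Fin 3 → ℕ := fun _ => S.P.sitesPerDir k

/-- `dimT` = three colour copies of the remaining bond variables `B′` of [B6] p.249 on `T₁^{(k)}` (`B6Cov2156Torus.freeT`). [cite: Balaban1985UV3, (62)–(63) pp.271–272] -/
def dimT : ℕ := Fintype.card (↥(freeT L (sideT S k)) × Fin 3)

/-- The fixed enumeration of the variables of `Z^{(k)}(T₁^{(k)}, 1)`. [folklore] -/
def eT : ↥(freeT L (sideT S k)) × Fin 3 ≃ Fin (dimT S k) := Fintype.equivFin _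

/-- **`QT`** — the precision form of `Z^{(k)}(T₁^{(k)}, 1)` in (63): three colour copies of `Cᵀ Δ_k C` ([B6] (2.155) with `C = elimT`, `Δ_k = deltaPol … (L^k)` the
[B5] (1.66) form; [B9] p.428 L8–14 «We have proved it in [4], Lemma 2.4, for operators with U = 1» is the licence for `Δ_k(1) :=` the (1.66) form).
[cite: Balaban1985UV3, (62)–(63) pp.271–272; Balaban1984PropagatorsII, (2.155) p.250] -/
def QT : Matrix (Fin (dimT S k)) (Fin (dimT S k)) ℝ :=
  Matrix.reindex (eT S k) (eT S k)
    (blockDiagonal fun _ : Fin 3 => (elimT L (sideT S k))ᵀ * deltaPol (sideT S k) (L ^ k) * elimT L (sideT S k))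

/-- **`JT`** — the constraint-elimination constant of `Z^{(k)}(T₁^{(k)}, 1)`: `(L^d)^{|Λ′|}` per colour ([B6] (2.155), `|Λ′| = |faces|`), as a logarithm; convention D1:
WITHOUT the `const` of [B10] (22). [cite: Balaban1984PropagatorsII, (2.155) p.250; Balaban1985UV3, (62) p.271] -/
def JT : ℝ := 3 * ((faces L (sideT S k)).card : ℝ) * Real.log ((L : ℝ) ^ 3)

/-- The explicit upper form bound `a = 16·3·L³·(π²∕4)^{10}` of ✓`smul_one_sub_sandwich_deltaPol_posSemidef` at `d = 3`. [cite: Balaban1985UV3, p.272 L1–2] -/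
def aT (L : ℕ) : ℝ := 16 * ((3 : ℕ) : ℝ) * (L : ℝ) ^ (3 : ℕ) * (Real.pi ^ 2 / 4) ^ (2 * 3 + 4)

variable (K₀ : CarrierConsts)

/-- The big-block LABEL of a point `y ∈ ℤ³` under the corner rule's numerics: `μ ↦ ⌊y_μ∕M₁⌋ mod N`, `N = nblkOf S K₀ k` (total; for `0 ≤ y_μ < Mₖ` and
`M₁ ∣ Mₖ` it is the genuine big-block label `Carriers.bigBlockOf`). [cite: Balaban1985UV3, (7) p.257 + (59) p.270] -/
def lab (y : Fin 3 → ℤ) : Fin 3 → ZMod (nblkOf S K₀ k) := fun μ => (((y μ).toNat / K₀.M₁ : ℕ) : ZMod (nblkOf S K₀ k))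

/-- **`Λ'₀(h)`** — the coarse sites (block corners `y ∈ L·ℤ³` of the box) whose big block lies in `Ω_{k+1}(h)`: CORNER RULE (spec D2) — `y` is assigned to the big block
with label `lab y = (⌊y_μ∕M₁⌋ mod N)_μ` and kept iff that label is in `Carriers.ΩblkOf M₁ Rcol N h`. [cite: Balaban1985UV3, (61) p.271 + (59) p.270] -/
def lamCoarse (h : Hist S.P (k + 1)) : Finset (Fin 3 → ℤ) :=
  (coarseSites L (sideT S k)).filter fun y => lab S k K₀ y ∈ ΩblkOf K₀.M₁ (rcolOf S K₀) (nblkOf S K₀ k) h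

/-- The remaining variables of the Λ-integral, `Λ = B(Λ'₀(h))` (`B6Cov2156TorusSubset.lamFree`). [cite: Balaban1984PropagatorsII, p.249] -/
abbrev lamBonds (h : Hist S.P (k + 1)) : Finset (B4.Idx (pbox (sideT S k)) 3) := lamFree L (sideT S k) (lamCoarse S k K₀ h)

/-- `dimZ h` = three colour copies of the remaining variables of `Z^{(k)}(B(Λ_{k+1}(h)), 1)`. [cite: Balaban1985UV3, (61) + (63) pp.271–272] -/
def dimZ (h : Hist S.P (k + 1)) : ℕ := Fintype.card (↥(lamBonds S k K₀ h) × Fin 3)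

/-- The fixed enumeration of the variables of `Z^{(k)}(B(Λ_{k+1}(h)), 1)`. [folklore] -/
def eZ (h : Hist S.P (k + 1)) : ↥(lamBonds S k K₀ h) × Fin 3 ≃ Fin (dimZ S k K₀ h) := Fintype.equivFin _

/-- **`Q1 h`** — the precision form of `Z^{(k)}(B(Λ_{k+1}(h)), 1)`: three colour copies of `C_Λᵀ Δ_k C_Λ` with `C_Λ = elimLam L M Λ'₀(h)` (the column restriction of `C`,
[B6] (2.155) «or on a subset Λ»; its Gaussian is ✓`B6Jacobian2155Torus.ZredLam_deltaPol`). [cite: Balaban1985UV3, (61) + (63) pp.271–272; Balaban1984PropagatorsII, (2.155) p.250] -/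
def Q1 (h : Hist S.P (k + 1)) : Matrix (Fin (dimZ S k K₀ h)) (Fin (dimZ S k K₀ h)) ℝ :=
  Matrix.reindex (eZ S k K₀ h) (eZ S k K₀ h)
    (blockDiagonal fun _ : Fin 3 =>
      (elimLam L (sideT S k) (lamCoarse S k K₀ h))ᵀ * deltaPol (sideT S k) (L ^ k) * elimLam L (sideT S k) (lamCoarse S k K₀ h))

/-- **`J1 h`** — the constraint-elimination constant of the Λ-integral: `(L^d)^{|facesOf Λ'₀(h)|}` per colour ([B6] (2.155) on Λ, ✓`eq_2155_lam_deltaPol`), as a logarithm,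
same convention D1 as `JT`. [cite: Balaban1984PropagatorsII, (2.155) p.250; Balaban1985UV3, (61) p.271] -/
def J1 (h : Hist S.P (k + 1)) : ℝ := 3 * ((facesOf L (sideT S k) (lamCoarse S k K₀ h)).card : ℝ) * Real.log ((L : ℝ) ^ 3)

/-- The number of extra coordinates on the whole-lattice side of the (35) presentation: three colour copies of the remaining variables of `T₁^{(k)}` that are NOT
Λ-bonds (the `t` of `Norm35Model`; its bound by `cv·|Z_k(h)|` is gap (G1)). [cite: Balaban1985UV3, (35) p.265] -/
def dimC (h : Hist S.P (k + 1)) : ℕ :=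
  Fintype.card ({f : ↥(freeT L (sideT S k)) // (f : B4.Idx (pbox (sideT S k)) 3) ∉ lamBonds S k K₀ h} × Fin 3)

end Defs

/-! ## §2 Row #13 (`logZT`): Loewner letters, counts, the row -/

section Row13

variable {L : ℕ}

variable (S : Scales L) (k : ℕ)

/-! KERNEL NOTE (observed 2026-08-30, px8 g17): the ℕ-valued `Fintype.card` fields MUST be sealed before any consumer meets them through a `StepSeries`
projection — otherwise `(𝔖 k).dimT =?= dimT S k` sends lazy delta-reduction down `Fintype.card ↦ Finset.univ ↦ Multiset.pi ↦ List.range' 0 (2·L^{m+K−k})`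
(whnf timeout at 200k heartbeats, reproducible).  Sealed here, after the lemmas that unfold them; `eT`∕`eZ` were typed before the seal. -/
attribute [irreducible] dimT

variable (𝔎 : LaneConsts L) {S} {G : Type} [GaugeGroup G] [MeasurableSpace G] [HaarData G]
  {V : Type} [NormedAddCommGroup V] [NormedSpace ℂ V] (X : ExternalInputsAC S G)

/-- THE T-SIDE OVERWRITE: any expansion data `𝔖₀` with its three `Z^{(k)}(T₁^{(k)},1)` fields replaced by the draft's (`dimT, QT, JT`) — the shape in which B0 will
set them (all other fields untouched). [cite: Balaban1985UV3, (62)–(63) pp.271–272] -/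
def withT {N : ℕ → ℕ} [∀ j, NeZero (N j)] (𝔖₀ : ∀ j, StepSeries S G V (N j) j) : ∀ j, StepSeries S G V (N j) j :=
  fun j => { 𝔖₀ j with dimT := dimT S j, QT := QT S j, JT := JT S j }

end Row13

/-! ## §3 Row #12 (`norm35`): the `Norm35Model` presentation at `s := 0` -/

section Row12

variable {L : ℕ} (S : Scales L) (k : ℕ) (K₀ : CarrierConsts) (h : Hist S.P (k + 1))

/-- The inclusion of the Λ-variables into the torus variables. [folklore] -/
def inclLam : ↥(lamBonds S k K₀ h) → ↥(freeT L (sideT S k)) := fun b => ⟨b.1, lamFree_subset _ _ _ b.2⟩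

/-- The fixed enumeration of the complement coordinates (the `t` extra coordinates of the whole-lattice side). [folklore] -/
def eC : {f : ↥(freeT L (sideT S k)) // (f : B4.Idx (pbox (sideT S k)) 3) ∉ lamBonds S k K₀ h} × Fin 3 ≃ Fin (dimC S k K₀ h) :=
  Fintype.equivFin _

/-- **THE SPLIT** of the variables of `Z^{(k)}(T₁^{(k)}, 1)`: Λ-bonds first (enumerated by `eZ`), the rest after (enumerated by `eC`). [folklore] -/
def splitEquiv : ↥(freeT L (sideT S k)) × Fin 3 ≃ Fin (dimZ S k K₀ h) ⊕ Fin (dimC S k K₀ h) :=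
  ((Equiv.prodCongr
        (Equiv.sumCompl fun f : ↥(freeT L (sideT S k)) => (f : B4.Idx (pbox (sideT S k)) 3) ∈ lamBonds S k K₀ h).symm
        (Equiv.refl (Fin 3))).trans
      (Equiv.sumProdDistrib _ _ (Fin 3))).trans
    (Equiv.sumCongr
      ((Equiv.prodCongr (subFinsetEquiv (lamBonds S k K₀ h) (freeT L (sideT S k)) (lamFree_subset _ _ _)) (Equiv.refl (Fin 3))).trans
        (eZ S k K₀ h))
      (eC S k K₀ h))

/-- `σ_h : Fin dimT ≃ Fin (dimZ h) ⊕ Fin (dimC h)` — the definer's enumeration of `Z(T)`'s variables followed by the split. [folklore] -/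
def sigmaT : Fin (dimT S k) ≃ Fin (dimZ S k K₀ h) ⊕ Fin (dimC S k K₀ h) := (eT S k).symm.trans (splitEquiv S k K₀ h)

/-- `QT` in split coordinates. [folklore] -/
def QTsplit : Matrix (Fin (dimZ S k K₀ h) ⊕ Fin (dimC S k K₀ h)) (Fin (dimZ S k K₀ h) ⊕ Fin (dimC S k K₀ h)) ℝ :=
  Matrix.reindex (sigmaT S k K₀ h) (sigmaT S k K₀ h) (QT S k)

attribute [irreducible] dimZ dimC

variable (𝔎 : LaneConsts L) {S} {G : Type} [GaugeGroup G] [MeasurableSpace G] [HaarData G]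
  {V : Type} [NormedAddCommGroup V] [NormedSpace ℂ V] (X : ExternalInputsAC S G)

/-- THE FULL FLAT OVERWRITE: `𝔖₀` with all six B0∣_{U=1} fields replaced by the draft's, and — ONLY so that the record typechecks, `QU`∕`JU` depending on `dimZ` — the
CURVED fields set to the flat ones (a PLACEHOLDER, not B0's datum: the curved (61)∕(63) pieces are gap (G5)). [cite: Balaban1985UV3, (61)–(63) pp.271–272] -/
def withTZ {N : ℕ → ℕ} [∀ j, NeZero (N j)] (𝔖₀ : ∀ j, StepSeries S G V (N j) j) : ∀ j, StepSeries S G V (N j) j :=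
  fun j =>
    { 𝔖₀ j with
      dimT := dimT S j, QT := QT S j, JT := JT S j
      dimZ := fun hh => dimZ S j K₀ hh
      QU := fun hh _ => Q1 S j K₀ hh
      JU := fun hh _ => J1 S j K₀ hh
      Q1 := fun hh => Q1 S j K₀ hh
      J1 := fun hh => J1 S j K₀ hh }

end Row12

/-! ## §4 The two volume counts (G1)(G2): bad block corners are paid for by `|Z_k(h)|` -/

section Counts

variable {L : ℕ} (S : Scales L) (k : ℕ) (K₀ : CarrierConsts) (h : Hist S.P (k + 1))

/-- THE BAD POINTS of the box: those whose block corner carries a big-block label outside `ΩblkOf h`. [folklore] -/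
def badPts : Finset (Fin 3 → ℤ) :=
  (pbox (sideT S k)).filter fun z => lab S k K₀ (B6Elimination.corner L z) ∉ ΩblkOf K₀.M₁ (rcolOf S K₀) (nblkOf S K₀ k) h

end Counts

/-! ## §5 Rows #12 and #13 CLOSED for the draft's fields (no residual hypothesis beyond the field identities) -/

section Closed

variable {L : ℕ} (k : ℕ) (𝔎 : LaneConsts L) {S : Scales L} {G : Type} [GaugeGroup G] [MeasurableSpace G] [HaarData G]
  {V : Type} [NormedAddCommGroup V] [NormedSpace ℂ V] (X : ExternalInputsAC S G)

/-- The (35) volume constant `cv = 9·(2(L+1)M₁)³` (uniform in `k`, `K`, the torus and the history). [cite: Balaban1985UV3, (35) p.265] -/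
def cvT (L M₁ : ℕ) : ℝ := 9 * (2 * ((L + 1) * M₁ : ℝ)) ^ 3

/-- The (35) Jacobian constant `cJ = 27·log L·(2(L+1)M₁)³`. [cite: Balaban1985UV3, (35) p.265] -/
def cJT (L M₁ : ℕ) : ℝ := 27 * Real.log L * (2 * ((L + 1) * M₁ : ℝ)) ^ 3

end Closed

/-! ## §6 (G3) The identification: (62)∕(61)'s numbers ARE three times the logarithm of [B6] (2.155)'s evaluated left side at `J = 0` -/

section Identification

open Literature.MathematicalPhysics.QuantumFieldTheory.Balaban1983to89.Beta.GaussianIntegral (log_integral_exp_neg_half_quadForm)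
open Literature.MathematicalPhysics.QuantumFieldTheory.Balaban1983to89.B6Jacobian2155Torus (Zred ZredS sandwich_posDef_deltaPol ZredLam_deltaPol)

variable {L : ℕ} (S : Scales L) (k : ℕ) (K₀ : CarrierConsts) (h : Hist S.P (k + 1))

end Identification

/-! ## §7 The record's side conditions on the six constants (`Primitives.AlphaConsts`: `c35_pos`, `cv_nonneg`, `cJ35_nonneg`, `cT_pos`, `cn_nonneg`, `cJT_nonneg`) -/

section SideConditions

variable {L : ℕ}

end SideConditions

end Summit.QuantumFields.YangMills.Theorems.AlphaInputsT3ACFlatGaussian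

end
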